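import Summits.NavierStokesRegularity.NavierStokesRegularity.Theses.SqueezeCycle
import Summits.NavierStokesRegularity.NavierStokesRegularity.Theorems.SqueezeCycleExtremalBiaxialitySubcriticalGaugeStrainBound
import Summits.NavierStokesRegularity.NavierStokesRegularity.Theorems.SqueezeCycleExtremalBiaxialitySubcriticalCubicProductionBound
import Summits.NavierStokesRegularity.NavierStokesRegularity.Theorems.SqueezeCycleExtremalBiaxialitySubcriticalReductions
import Summits.NavierStokesRegularity.NavierStokesRegularity.Theorems.SqueezeCycleExtremalBiaxialitySubcriticalExtremal
import Summits.NavierStokesRegularity.NavierStokesRegularity.Theorems.ExtremalBiaxialitySubcritical.Negative.MaximalityFree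
import Summits.NavierStokesRegularity.NavierStokesRegularity.Theorems.ExtremalBiaxialitySubcritical.Negative.LoadBearing
import Summits.NavierStokesRegularity.NavierStokesRegularity.Theorems.SqueezeCycleStrainAlgebra
import Summits.NavierStokesRegularity.NavierStokesRegularity.Theorems.SqueezeCycleMustSqueezeAlgebra
import Literature.Analysis.FluidPDE.LerayGaugeStrainSpectrum

/-!
# drefute (generation 2) — line `quarter-bootstrap-pinning` of crux `ExtremalBiaxialitySubcritical`
# (stmt-NavierStokesRegularity-11609): what the stub set IS, certified

Stub signatures are copied VERBATIM from the lead skeleton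
`Cruxes/ExtremalBiaxialitySubcritical/Lines/quarter-bootstrap-pinning.lean` (2026-08-16T00:20Z).
All theorems sorry-free. Findings (see the per-stub notes for prose):

* §0 `gaugeStrainBound_landed`, `cubicProductionBound_landed` — the two "true" stubs are the tree
  theorems of the same names with the skeleton's signatures on the nose (p72389, p72572); the gauge
  bound enters §2–§4 as the hypothesis `hG` (bookkeeping of what is used) and is discharged in §5.
* §1 `leaky_iff_leakyNonneg` — negative thresholds `b < 0` in `stub_leakyQuarterLawCeiling` are
  decoration (monotonicity of the production ceiling in `b`); `msFamily_of_leakyNonneg`,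
  `mustSqueeze_of_leaky` — the stub IMPLIES the sibling crux `MustSqueeze` and its whole family below
  `1/4` (Λ-ceiling `a ≥ 0` ⇒ production ceiling `a`, tree `neg_det_half_add_transpose_le`); the
  converse supply holds only below `1/6` (generation 1, `leakyBelow_sixth_of_mustSqueezeFamily`,
  `dictionary_sharp`).
* §2 `largeExcess_iff_forall_le_quarter` — UNCONDITIONALLY (the gauge strain bound and the
  existence of extremal elements being tree theorems now), `stub_largeExcessExclusion` is the
  pointwise a-priori bound "`Λ ≤ 1/4` at every point of every element of every `𝒦_C`": `K`, the
  cubic margin, the extremal element and the attainment clause are all cosmetic.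
* §3 `crux_of_leakyNonneg_of_largeExcess` (the composition re-run over the landed stubs, consuming the
  leaky law only at thresholds `b ∈ [0, 1/4)`), `squeezeLiouville_iff_leaky_and_largeExcess` —
  **the two open stubs are jointly EQUIVALENT to the route target X = `SqueezeLiouville`**: the line
  closes the crux only by closing the whole target (crux AND sibling crux `MustSqueeze`).
* §4 `crux_iff_largeExcess_and_ne_quarter` — given the `MustSqueeze` family (⇐ the leaky stub), the
  crux is `stub_largeExcessExclusion` plus "`Λ ≠ 1/4` everywhere": the production-currency leaky law
  and the cubic refinement buy exactly the single value `Λ = 1/4`.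
-/

noncomputable section

open MeasureTheory Set Filter Topology
open scoped RealInnerProductSpace Matrix

set_option linter.dupNamespace false

namespace Summit.NavierStokesRegularity.NavierStokesRegularity.Cruxes.ExtremalBiaxialitySubcritical.DrefuteQBP2

open Literature.Analysis.FluidPDE
open Summit.NavierStokesRegularity.NavierStokesRegularity.Theses
open Summit.NavierStokesRegularity.NavierStokesRegularity.Theorems
open Summit.NavierStokesRegularity.NavierStokesRegularity.Theorems.ExtremalBiaxialitySubcritical.Negative

/-- Physical space. -/
local notation "ℝ³" => EuclideanSpace ℝ (Fin 3)

/-! ## Verbatim texts -/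

/-- `InK C u`: the inline Type-I model class `𝒦_C` of route `SqueezeCycle`, VERBATIM. -/
def InK (C : ℝ) (u : ℝ → EuclideanSpace ℝ (Fin 3) → EuclideanSpace ℝ (Fin 3)) : Prop :=
  ContDiffOn ℝ (⊤ : ℕ∞) (Function.uncurry u) (Set.Iio 0 ×ˢ Set.univ) ∧ (∀ t < 0, Literature.Analysis.FluidPDE.VectorCalculus.IsDivFree (u t)) ∧ (∀ s t : ℝ, s < t → t < 0 → ∀ x, u t x = Literature.Analysis.FluidPDE.heatFlow (u s) (t-s) x - ∫ τ in Set.Ioo s t, ∫ y, ((-(inner ℝ (x-y) (u τ y) / (2*(t-τ)) * Literature.Analysis.UnboundedOperators.heatKernel (t-τ) (x-y))) • u τ y + (∫ σ in Set.Ioi (t-τ), Literature.Analysis.UnboundedOperators.heatKernel σ (x-y) / (4*σ^2)) • (inner ℝ (x-y) (u τ y) • u τ y + inner ℝ (u τ y) (u τ y) • (x-y) + inner ℝ (x-y) (u τ y) • u τ y) - ((∫ σ in Set.Ioi (t-τ), Literature.Analysis.UnboundedOperators.heatKernel σ (x-y) / (8*σ^3)) * (inner ℝ (x-y) (u τ y)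 * inner ℝ (x-y) (u τ y))) • (x-y))) ∧ Literature.Analysis.FluidPDE.HasTypeITimeDecay C u ∧ (∀ (x₀ : EuclideanSpace ℝ (Fin 3)) (t₀ r : ℝ), t₀ ≤ 0 → 0 < r → (∀ t, t₀ - r^2 < t → t < t₀ → r⁻¹ * ∫ x in Metric.ball x₀ r, ‖u t x‖^2 ≤ C) ∧ r⁻¹ * ∫ t in Set.Ioo (t₀ - r^2) t₀, ∫ x in Metric.ball x₀ r, ‖fderiv ℝ (u t) x‖^2 ≤ C)

/-- VERBATIM signature of `stub_gaugeStrainBound` (lead skeleton). -/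
def S_stub_gaugeStrainBound : Prop :=
  ∀ C : ℝ, ∃ K : ℝ, 0 < K ∧ ∀ (v' : ℝ → EuclideanSpace ℝ (Fin 3) → EuclideanSpace ℝ (Fin 3)), ContDiffOn ℝ (⊤ : ℕ∞) (Function.uncurry v') (Set.Iio 0 ×ˢ Set.univ) ∧ (∀ t < 0, Literature.Analysis.FluidPDE.VectorCalculus.IsDivFree (v' t)) ∧ (∀ s t : ℝ, s < t → t < 0 → ∀ x, v' t x = Literature.Analysis.FluidPDE.heatFlow (v' s) (t-s) x - ∫ τ in Set.Ioo s t, ∫ y, ((-(inner ℝ (x-y) (v' τ y) / (2*(t-τ)) * Literature.Analysis.UnboundedOperators.heatKernel (t-τ) (x-y))) • v' τ y + (∫ σ in Set.Ioi (t-τ), Literature.Analysis.UnboundedOperators.heatKernel σ (x-y) / (4*σ^2)) • (inner ℝ (x-y) (v' τ y) • v' τ y + inner ℝ (v' τ y) (v' τ y) • (x-y) + inner ℝ (x-y) (v' τ y) • v' τ y) - ((∫ σ in Set.Ioi (t-τ), Literature.Analysis.UnboundedOperators.heatKernel σ (x-y) / (8*σ^3)) * (inner ℝ (x-y) (v' τ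 y) * inner ℝ (x-y) (v' τ y))) • (x-y))) ∧ Literature.Analysis.FluidPDE.HasTypeITimeDecay C v' ∧ (∀ (x₀ : EuclideanSpace ℝ (Fin 3)) (t₀ r : ℝ), t₀ ≤ 0 → 0 < r → (∀ t, t₀ - r^2 < t → t < t₀ → r⁻¹ * ∫ x in Metric.ball x₀ r, ‖v' t x‖^2 ≤ C) ∧ r⁻¹ * ∫ t in Set.Ioo (t₀ - r^2) t₀, ∫ x in Metric.ball x₀ r, ‖fderiv ℝ (v' t) x‖^2 ≤ C) → ∀ t < 0, ∀ x, (∑ i, ∑ j, (((1 / 2 : ℝ) • (Literature.Analysis.FluidPDE.stdMatrix (fderiv ℝ (v' t) x : EuclideanSpace ℝ (Fin 3) →ₗ[ℝ] EuclideanSpace ℝ (Fin 3)) + (Literature.Analysis.FluidPDE.stdMatrix (fderiv ℝ (v' t) x : EuclideanSpace ℝ (Fin 3) →ₗ[ℝ] EuclideanSpace ℝ (Fin 3)))ᵀ)) i j) ^ 2) ≤ (K / (-t)) ^ 2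

/-- VERBATIM signature of `stub_cubicProductionBound` (lead skeleton). -/
def S_stub_cubicProductionBound : Prop :=
  ∀ (A : Matrix (Fin 3) (Fin 3) ℝ) (m K : ℝ), A.trace = 0 → 0 ≤ m → 0 < K → 6 * m ^ 2 ≤ K ^ 2 → (Matrix.isHermitian_add_transpose_self A).eigenvalues₀ 1 ≤ 2 * m → (∑ i, ∑ j, (((1 / 2 : ℝ) • (A + Aᵀ)) i j) ^ 2) ≤ K ^ 2 → -4 * (((1 / 2 : ℝ) • (A + Aᵀ))).det ≤ (2 * m - 4 * m ^ 3 / K ^ 2) * (∑ i, ∑ j, (((1 / 2 : ℝ) • (A + Aᵀ)) i j) ^ 2)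

/-- VERBATIM signature of `stub_leakyQuarterLawCeiling` (lead skeleton). -/
def S_stub_leakyQuarterLawCeiling : Prop :=
  ∀ (C b : ℝ), b < 1 / 4 → ∀ (u : ℝ → EuclideanSpace ℝ (Fin 3) → EuclideanSpace ℝ (Fin 3)), ContDiffOn ℝ (⊤ : ℕ∞) (Function.uncurry u) (Set.Iio 0 ×ˢ Set.univ) ∧ (∀ t < 0, Literature.Analysis.FluidPDE.VectorCalculus.IsDivFree (u t)) ∧ (∀ s t : ℝ, s < t → t < 0 → ∀ x, u t x = Literature.Analysis.FluidPDE.heatFlow (u s) (t-s) x - ∫ τ in Set.Ioo s t, ∫ y, ((-(inner ℝ (x-y) (u τ y) / (2*(t-τ)) * Literature.Analysis.UnboundedOperators.heatKernel (t-τ) (x-y))) • u τ y + (∫ σ in Set.Ioi (t-τ), Literature.Analysis.UnboundedOperators.heatKernel σ (x-y) / (4*σ^2)) • (inner ℝ (x-y) (u τ y) • u τ y + inner ℝ (u τ y) (u τ y) • (x-y) + inner ℝ (x-y) (u τ y) • u τ y) - ((∫ σ in Set.Ioi (t-τ), Literature.Analysis.UnboundedOperators.heatKernel σ (x-y) / (8*σ^3))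 * (inner ℝ (x-y) (u τ y) * inner ℝ (x-y) (u τ y))) • (x-y))) ∧ Literature.Analysis.FluidPDE.HasTypeITimeDecay C u ∧ (∀ (x₀ : EuclideanSpace ℝ (Fin 3)) (t₀ r : ℝ), t₀ ≤ 0 → 0 < r → (∀ t, t₀ - r^2 < t → t < t₀ → r⁻¹ * ∫ x in Metric.ball x₀ r, ‖u t x‖^2 ≤ C) ∧ r⁻¹ * ∫ t in Set.Ioo (t₀ - r^2) t₀, ∫ x in Metric.ball x₀ r, ‖fderiv ℝ (u t) x‖^2 ≤ C) → (∀ t < 0, ∀ x, -4 * (((1 / 2 : ℝ) • (Literature.Analysis.FluidPDE.stdMatrix (fderiv ℝ (u t) x : EuclideanSpace ℝ (Fin 3) →ₗ[ℝ] EuclideanSpace ℝ (Fin 3)) + (Literature.Analysis.FluidPDE.stdMatrix (fderiv ℝ (u t) x : EuclideanSpace ℝ (Fin 3) →ₗ[ℝ] EuclideanSpace ℝ (Fin 3)))ᵀ))).det ≤ (2 * b / (-t)) * (∑ i, ∑ j, (((1 / 2 : ℝ) • (Literature.Analysis.FluidPDE.stdMatrix (fderiv ℝ (u t) x : EuclideanSpace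 ℝ (Fin 3) →ₗ[ℝ] EuclideanSpace ℝ (Fin 3)) + (Literature.Analysis.FluidPDE.stdMatrix (fderiv ℝ (u t) x : EuclideanSpace ℝ (Fin 3) →ₗ[ℝ] EuclideanSpace ℝ (Fin 3)))ᵀ)) i j) ^ 2)) → ∀ t < 0, ∀ x, u t x = 0

/-- VERBATIM signature of `stub_largeExcessExclusion` (lead skeleton). -/
def S_stub_largeExcessExclusion : Prop :=
  ∀ (C K m : ℝ) (u : ℝ → EuclideanSpace ℝ (Fin 3) → EuclideanSpace ℝ (Fin 3)) (t₀ : ℝ) (x₀ : EuclideanSpace ℝ (Fin 3)), 0 < K → (∀ (v' : ℝ → EuclideanSpace ℝ (Fin 3) → EuclideanSpace ℝ (Fin 3)), ContDiffOn ℝ (⊤ : ℕ∞) (Function.uncurry v') (Set.Iio 0 ×ˢ Set.univ) ∧ (∀ t < 0, Literature.Analysis.FluidPDE.VectorCalculus.IsDivFree (v' t)) ∧ (∀ s t : ℝ, s < t → t < 0 → ∀ x, v' t x = Literature.Analysis.FluidPDE.heatFlow (v' s) (t-s) x - ∫ τ in Set.Ioo s t, ∫ y, ((-(inner ℝ (x-y)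 (v' τ y) / (2*(t-τ)) * Literature.Analysis.UnboundedOperators.heatKernel (t-τ) (x-y))) • v' τ y + (∫ σ in Set.Ioi (t-τ), Literature.Analysis.UnboundedOperators.heatKernel σ (x-y) / (4*σ^2)) • (inner ℝ (x-y) (v' τ y) • v' τ y + inner ℝ (v' τ y) (v' τ y) • (x-y) + inner ℝ (x-y) (v' τ y) • v' τ y) - ((∫ σ in Set.Ioi (t-τ), Literature.Analysis.UnboundedOperators.heatKernel σ (x-y) / (8*σ^3)) * (inner ℝ (x-y) (v' τ y) * inner ℝ (x-y) (v' τ y))) • (x-y))) ∧ Literature.Analysis.FluidPDE.HasTypeITimeDecay C v' ∧ (∀ (x₀ : EuclideanSpace ℝ (Fin 3)) (t₀ r : ℝ), t₀ ≤ 0 → 0 < r → (∀ t, t₀ - r^2 < t → t < t₀ → r⁻¹ * ∫ x in Metric.ball x₀ r, ‖v' t x‖^2 ≤ C) ∧ r⁻¹ * ∫ t in Set.Ioo (t₀ - r^2) t₀, ∫ x in Metric.ball x₀ r, ‖fderiv ℝ (v' t) x‖^2 ≤ C) → ∀ t < 0, ∀ x, (∑ i, ∑ j, (((1 / 2 : ℝ)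 • (Literature.Analysis.FluidPDE.stdMatrix (fderiv ℝ (v' t) x : EuclideanSpace ℝ (Fin 3) →ₗ[ℝ] EuclideanSpace ℝ (Fin 3)) + (Literature.Analysis.FluidPDE.stdMatrix (fderiv ℝ (v' t) x : EuclideanSpace ℝ (Fin 3) →ₗ[ℝ] EuclideanSpace ℝ (Fin 3)))ᵀ)) i j) ^ 2) ≤ (K / (-t)) ^ 2 ∧ Literature.Analysis.FluidPDE.lerayMiddleStrain v' t x ≤ m) → 0 ≤ m → 1 / 4 ≤ m - 2 * m ^ 3 / K ^ 2 → t₀ < 0 → (ContDiffOn ℝ (⊤ : ℕ∞) (Function.uncurry u) (Set.Iio 0 ×ˢ Set.univ) ∧ (∀ t < 0, Literature.Analysis.FluidPDE.VectorCalculus.IsDivFree (u t)) ∧ (∀ s t : ℝ, s < t → t < 0 → ∀ x, u t x = Literature.Analysis.FluidPDE.heatFlow (u s) (t-s) x - ∫ τ in Set.Ioo s t, ∫ y, ((-(inner ℝ (x-y) (u τ y) / (2*(t-τ)) * Literature.Analysis.UnboundedOperators.heatKernel (t-τ) (x-y))) • u τ y + (∫ σ in Set.Ioi (t-τ), Literature.Analysis.UnboundedOperators.heatKernel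 σ (x-y) / (4*σ^2)) • (inner ℝ (x-y) (u τ y) • u τ y + inner ℝ (u τ y) (u τ y) • (x-y) + inner ℝ (x-y) (u τ y) • u τ y) - ((∫ σ in Set.Ioi (t-τ), Literature.Analysis.UnboundedOperators.heatKernel σ (x-y) / (8*σ^3)) * (inner ℝ (x-y) (u τ y) * inner ℝ (x-y) (u τ y))) • (x-y))) ∧ Literature.Analysis.FluidPDE.HasTypeITimeDecay C u ∧ (∀ (x₀ : EuclideanSpace ℝ (Fin 3)) (t₀ r : ℝ), t₀ ≤ 0 → 0 < r → (∀ t, t₀ - r^2 < t → t < t₀ → r⁻¹ * ∫ x in Metric.ball x₀ r, ‖u t x‖^2 ≤ C) ∧ r⁻¹ * ∫ t in Set.Ioo (t₀ - r^2) t₀, ∫ x in Metric.ball x₀ r, ‖fderiv ℝ (u t) x‖^2 ≤ C)) → m ≤ Literature.Analysis.FluidPDE.lerayMiddleStrain u t₀ x₀ → False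

/-! ## §0 The two "true" stubs are landed, verbatim -/

/-- `stub_gaugeStrainBound` is the tree theorem of the same name (p72389), signature on the nose. Below it
enters the structural theorems as the hypothesis `hG` (so that they display exactly what is used); the
primed corollaries of §5 discharge it. -/
theorem gaugeStrainBound_landed : S_stub_gaugeStrainBound := stub_gaugeStrainBound

/-- `stub_cubicProductionBound` is the tree theorem of the same name (p72572), signature on the nose. -/
theorem cubicProductionBound_landed : S_stub_cubicProductionBound := stub_cubicProductionBound

/-! ## §1 The leaky quarter law: thresholds, and what it supplies to the sibling crux -/

/-- The pointwise PRODUCTION ceiling at threshold `b`: `−4 det S(t,x) ≤ (2b/(−t)) |S(t,x)|²_F` at every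
`t < 0`, `x` (the hypothesis of `stub_leakyQuarterLawCeiling`, verbatim). -/
def ProdCeiling (b : ℝ) (u : ℝ → ℝ³ → ℝ³) : Prop :=
  ∀ t < 0, ∀ x, -4 * (((1 / 2 : ℝ) • (Literature.Analysis.FluidPDE.stdMatrix (fderiv ℝ (u t) x : EuclideanSpace ℝ (Fin 3) →ₗ[ℝ] EuclideanSpace ℝ (Fin 3)) + (Literature.Analysis.FluidPDE.stdMatrix (fderiv ℝ (u t) x : EuclideanSpace ℝ (Fin 3) →ₗ[ℝ] EuclideanSpace ℝ (Fin 3)))ᵀ))).det ≤ (2 * b / (-t)) * (∑ i, ∑ j, (((1 / 2 : ℝ) • (Literature.Analysis.FluidPDE.stdMatrix (fderiv ℝ (u t) x : EuclideanSpace ℝ (Fin 3) →ₗ[ℝ] EuclideanSpace ℝ (Fin 3)) + (Literature.Analysis.FluidPDE.stdMatrix (fderiv ℝ (u t) x : EuclideanSpace ℝ (Fin 3) →ₗ[ℝ] EuclideanSpace ℝ (Fin 3)))ᵀ)) i j) ^ 2)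

/-- Read-back (definitional): the stub is "`∀ C b, b < 1/4 → ∀ u ∈ 𝒦_C, ProdCeiling b u → u ≡ 0 on t < 0`". -/
theorem leaky_iff :
    S_stub_leakyQuarterLawCeiling ↔
      ∀ (C b : ℝ), b < 1 / 4 → ∀ u : ℝ → ℝ³ → ℝ³, InK C u → ProdCeiling b u → ∀ t < 0, ∀ x, u t x = 0 :=
  Iff.rfl

/-- `LeakyNonneg`: the stub restricted to thresholds `b ∈ [0, 1/4)` — all that the composition of the
line ever consumes (`crux_of_leakyNonneg_of_largeExcess`). -/
def LeakyNonneg : Prop :=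
  ∀ (C b : ℝ), 0 ≤ b → b < 1 / 4 → ∀ u : ℝ → ℝ³ → ℝ³, InK C u → ProdCeiling b u → ∀ t < 0, ∀ x, u t x = 0

/-- The production ceiling is monotone in the threshold. -/
theorem prodCeiling_mono {b b' : ℝ} (hbb' : b ≤ b') {u : ℝ → ℝ³ → ℝ³} (h : ProdCeiling b u) :
    ProdCeiling b' u := by
  intro t ht x
  refine (h t ht x).trans ?_
  apply mul_le_mul_of_nonneg_right _ (by positivity)
  apply div_le_div_of_nonneg_right _ (neg_pos.2 ht).le
  linarith

/-- **Negative thresholds are decoration**: `stub_leakyQuarterLawCeiling ⇔ LeakyNonneg` (a ceiling at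
`b < 0` is a ceiling at `0`). Mutation finding: the range `b < 0` of the stub carries no content. -/
theorem leaky_iff_leakyNonneg : S_stub_leakyQuarterLawCeiling ↔ LeakyNonneg := by
  refine ⟨fun h C b _ hb u hu hc => h C b hb u hu hc, fun h C b hb u hu hc => ?_⟩
  rcases le_or_gt 0 b with hb0 | hb0
  · exact h C b hb0 hb u hu hc
  · exact h C 0 le_rfl (by norm_num) u hu (prodCeiling_mono hb0.le hc)

/-- **Λ-ceiling ⇒ production ceiling, same threshold `a ≥ 0`** (pointwise on a divergence-free
field; Miller's `−4 det S ≤ 2λ₂⁺|S|²`, tree `neg_det_half_add_transpose_le`). -/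
theorem prodCeiling_of_lerayMiddleStrain_le {u : ℝ → ℝ³ → ℝ³} {a : ℝ} (ha : 0 ≤ a)
    (hdiv : ∀ t < 0, VectorCalculus.IsDivFree (u t))
    (hΛ : ∀ t < 0, ∀ x, lerayMiddleStrain u t x ≤ a) : ProdCeiling a u := by
  intro t ht x
  have ht' : 0 < -t := neg_pos.2 ht
  set M := Literature.Analysis.FluidPDE.stdMatrix (fderiv ℝ (u t) x : ℝ³ →ₗ[ℝ] ℝ³) with hM
  have htr : M.trace = 0 := by rw [hM, trace_stdMatrix]; exact hdiv t ht x
  have hμ : (Matrix.isHermitian_add_transpose_self M).eigenvalues₀ 1 ≤ 2 * (a / (-t)) := by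
    have h1 := hΛ t ht x
    rw [lerayMiddleStrain_eq_eigenvalues₀] at h1
    rw [mul_div_assoc', le_div_iff₀ ht']
    nlinarith
  have key := neg_det_half_add_transpose_le M htr (div_nonneg ha ht'.le) hμ
  have e : 2 * (a / (-t)) = 2 * a / (-t) := mul_div_assoc' 2 a (-t)
  rw [e] at key
  exact key

/-- `MSFamily`: "`MustSqueezeAt a` for every `a < 1/4`" — VERBATIM the hypothesis `hMS` of the tree's
`extremalBiaxialitySubcritical_bootstrap` / `crux_iff_forall_lerayMiddleStrain_lt_quarter`
(Λ-currency: the sibling line's deliverable shape). -/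
def MSFamily : Prop :=
  ∀ a : ℝ, a < 1 / 4 → ∀ (C : ℝ) (u : ℝ → EuclideanSpace ℝ (Fin 3) → EuclideanSpace ℝ (Fin 3)), InK C u → (∀ t < 0, ∀ x, (∃ v w : EuclideanSpace ℝ (Fin 3), ‖v‖ = 1 ∧ ‖w‖ = 1 ∧ inner ℝ v w = 0 ∧ ∀ α β : ℝ, (-t) * inner ℝ (fderiv ℝ (u t) x (α • v + β • w)) (α • v + β • w) ≤ a * (α^2 + β^2))) → ∀ t < 0, ∀ x, u t x = 0

/-- **This line's leaky stub (even restricted to `b ∈ [0,1/4)`) implies the sibling's whole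
`MustSqueeze` family below `1/4`.** (`a < 0` reduces to `a⁺ = 0`.) -/
theorem msFamily_of_leakyNonneg (hL : LeakyNonneg) : MSFamily := by
  intro a ha C u hu hΛ
  have ha0 : 0 ≤ max a 0 := le_max_right _ _
  have ha4 : max a 0 < 1 / 4 := max_lt ha (by norm_num)
  have hΛ' : ∀ t < 0, ∀ x, lerayMiddleStrain u t x ≤ max a 0 := fun t ht x =>
    ((lerayMiddleStrain_le_iff ht a).2 (hΛ t ht x)).trans (le_max_left _ _)
  exact hL C (max a 0) ha0 ha4 u hu (prodCeiling_of_lerayMiddleStrain_le ha0 hu.2.1 hΛ')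

/-- In particular **`stub_leakyQuarterLawCeiling ⇒ MustSqueeze`** (the sibling crux
stmt-NavierStokesRegularity-11610 itself, threshold `1/8`). -/
theorem mustSqueeze_of_leaky (hL : S_stub_leakyQuarterLawCeiling) : SqueezeCycle.MustSqueeze :=
  msFamily_of_leakyNonneg (leaky_iff_leakyNonneg.1 hL) (1 / 8) (by norm_num)

/-! ## §2 `stub_largeExcessExclusion` is the pointwise quarter bound — unconditionally -/

/-- **crux ⇒ `stub_largeExcessExclusion`** (generation 1, re-proved for self-containedness). -/
theorem largeExcess_of_crux (hX : SqueezeCycle.ExtremalBiaxialitySubcritical) :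
    S_stub_largeExcessExclusion := by
  intro C K m u t₀ x₀ hK hcls hm0 hreg ht₀ hu hatt
  have h8 : m < 1 / 8 := hX C m u t₀ x₀ ht₀ hu ((le_lerayMiddleStrain_iff ht₀ m).1 hatt)
    (fun v' hv' t ht x => (lerayMiddleStrain_le_iff ht m).1 (hcls v' hv' t ht x).2)
  have h3 : 0 ≤ 2 * m ^ 3 / K ^ 2 := by positivity
  linarith

/-- **`stub_largeExcessExclusion ⇔ "Λ ≤ 1/4 at every point of every element of every 𝒦_C"`**, with NO
hypothesis: `K`, the cubic margin `2m³/K²`, the extremal element and the attainment clause are all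
cosmetic. (⇒: a point with `Λ > 1/4` gives, by `classMax_attained` — the PROVED
`ExtremalElementExists` — an attained class maximum `m > 1/4`; inflate the class strain constant of
the tree's `stub_gaugeStrainBound` until `1/4 ≤ m − 2m³/K²`. ⇐: attainment forces `m ≤ 1/4`, then
`1/4 ≤ m − 2m³/K²`, `m ≥ 0` is absurd.) -/
theorem largeExcess_iff_forall_le_quarter (hG : S_stub_gaugeStrainBound) :
    S_stub_largeExcessExclusion ↔
      ∀ (C : ℝ) (u : ℝ → ℝ³ → ℝ³), InK C u → ∀ t < 0, ∀ x, lerayMiddleStrain u t x ≤ 1 / 4 := by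
  constructor
  · intro h C u hu t ht x
    have hC : 0 ≤ C := squeezeClass_constant_nonneg hu.2.2.2.1
    obtain ⟨w, m, hm0, hw, hGE, hmax⟩ := classMax_attained hC
    have hΛm : lerayMiddleStrain u t x ≤ m := (lerayMiddleStrain_le_iff ht m).2 (hmax u hu t ht x)
    suffices hm4 : m ≤ 1 / 4 from hΛm.trans hm4
    by_contra hgt
    rw [not_le] at hgt
    obtain ⟨K₀, hK₀, hKb⟩ := hG C
    have hm : 0 < m - 1 / 4 := by linarith
    set Q : ℝ := 2 * m ^ 3 / (m - 1 / 4) with hQ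
    have hQ0 : 0 < Q := by positivity
    set K : ℝ := K₀ + Q + 1 with hKdef
    have hK1 : 1 ≤ K := by rw [hKdef]; linarith
    have hKpos : 0 < K := by linarith
    have hK0K : K₀ ≤ K := by rw [hKdef]; linarith
    have hQK : Q ≤ K ^ 2 := by nlinarith
    have hreg : 1 / 4 ≤ m - 2 * m ^ 3 / K ^ 2 := by
      have hK2 : 0 < K ^ 2 := by positivity
      have h1 : 2 * m ^ 3 / K ^ 2 ≤ 2 * m ^ 3 / Q :=
        div_le_div_of_nonneg_left (by positivity) hQ0 hQK
      have h2 : 2 * m ^ 3 / Q = m - 1 / 4 := by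
        rw [hQ]
        have h2m : (2 : ℝ) * m ^ 3 ≠ 0 := by positivity
        field_simp
      linarith
    have hatt : m ≤ lerayMiddleStrain w (-1) 0 := (le_lerayMiddleStrain_iff (by norm_num) m).2 hGE
    refine h C K m w (-1) 0 hKpos (fun v' hv' s hs y => ⟨?_, (lerayMiddleStrain_le_iff hs m).2
      (hmax v' hv' s hs y)⟩) hm0 hreg (by norm_num) hw hatt
    calc _ ≤ (K₀ / (-s)) ^ 2 := hKb v' hv' s hs y
      _ ≤ (K / (-s)) ^ 2 := by
          have hs' : 0 < -s := neg_pos.2 hs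
          gcongr
  · intro h C K m u t₀ x₀ hK hcls hm0 hreg ht₀ hu hatt
    have hmle : m ≤ 1 / 4 := hatt.trans (h C u hu t₀ ht₀ x₀)
    have h3 : 0 ≤ 2 * m ^ 3 / K ^ 2 := by positivity
    have hz : 2 * m ^ 3 / K ^ 2 = 0 := by linarith
    rw [div_eq_zero_iff] at hz
    rcases hz with hz | hz
    · have hm3 : m ^ 3 = 0 := by linarith
      have hm0' : m = 0 := pow_eq_zero_iff (n := 3) (by norm_num) |>.1 hm3
      rw [hm0'] at hreg
      norm_num at hreg
    · exact absurd hz (by positivity)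

/-- Corollary: `stub_largeExcessExclusion` is also "every ATTAINED class maximum is `≤ 1/4`"
(generation 1's `NoAttainedClassMaxAboveQuarter`, now hypothesis-free) — and by `classMax_attained`
the two readings coincide. Recorded as the one-line consequence: under the stub, `max_{𝒦_C} Λ ≤ 1/4`. -/
theorem classMax_le_quarter_of_largeExcess (hG : S_stub_gaugeStrainBound)
    (h : S_stub_largeExcessExclusion) {C m t₀ : ℝ}
    {u : ℝ → ℝ³ → ℝ³} {x₀ : ℝ³} (ht₀ : t₀ < 0) (hu : InK C u) (hatt : m ≤ lerayMiddleStrain u t₀ x₀) :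
    m ≤ 1 / 4 :=
  hatt.trans ((largeExcess_iff_forall_le_quarter hG).1 h C u hu t₀ ht₀ x₀)

/-! ## §3 The open stub pair is the route target -/

/-- **The composition, re-run over the LANDED stubs and consuming the leaky law only on `[0, 1/4)`**:
`LeakyNonneg → stub_largeExcessExclusion → crux`. (Verbatim the lead's `ExtremalBiaxialitySubcritical_of`
with `stub_gaugeStrainBound` / `stub_cubicProductionBound` the tree theorems, plus `0 ≤ b`:
`b = m − 2m³/K² ≥ 2m/3` from `6m² ≤ K²`.) -/
theorem crux_of_leakyNonneg_of_largeExcess (hG : S_stub_gaugeStrainBound) (hL : LeakyNonneg)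
    (hE : S_stub_largeExcessExclusion) :
    SqueezeCycle.ExtremalBiaxialitySubcritical := by
  intro C m u t₀ x₀ ht₀ hu hGE hmax
  obtain ⟨K, hK, hKb⟩ := hG C
  have hC : 0 ≤ C := squeezeClass_constant_nonneg hu.2.2.2.1
  have hm0 : 0 ≤ m := nonneg_of_maximal hC hmax
  obtain ⟨hΛeq, hΛle⟩ := extremal_lerayMiddleStrain_eq ht₀ hu hGE hmax
  by_cases hreg : 1 / 4 ≤ m - 2 * m ^ 3 / K ^ 2
  · exact (hE C K m u t₀ x₀ hK
      (fun v' hv' t ht x => ⟨hKb v' hv' t ht x, hΛle v' hv' t ht x⟩) hm0 hreg ht₀ hu hΛeq.ge).elim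
  · replace hreg : m - 2 * m ^ 3 / K ^ 2 < 1 / 4 := not_le.1 hreg
    set b : ℝ := m - 2 * m ^ 3 / K ^ 2 with hb
    obtain ⟨h1, h2, h3, h4, h5⟩ := hu
    have htr : ∀ t < 0, ∀ x, (stdMatrix (fderiv ℝ (u t) x : ℝ³ →ₗ[ℝ] ℝ³)).trace = 0 := by
      intro t ht x
      rw [trace_stdMatrix]
      exact h2 t ht x
    -- `6 m² ≤ K²` from the attained value
    have h6 : 6 * m ^ 2 ≤ K ^ 2 := by
      have ht' : 0 < -t₀ := neg_pos.2 ht₀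
      set M := stdMatrix (fderiv ℝ (u t₀) x₀ : ℝ³ →ₗ[ℝ] ℝ³) with hM
      have hsix := six_mul_midStrain_sq_le M (htr t₀ ht₀ x₀)
      have hS := hKb u ⟨h1, h2, h3, h4, h5⟩ t₀ ht₀ x₀
      have hΛ : lerayMiddleStrain u t₀ x₀ =
          (-t₀) * (2⁻¹ * (Matrix.isHermitian_add_transpose_self M).eigenvalues₀ 1) :=
        lerayMiddleStrain_eq_eigenvalues₀
      rw [hΛeq] at hΛ
      have hKt : ((K / (-t₀)) ^ 2) * (-t₀) ^ 2 = K ^ 2 := by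
        have ht0 : t₀ ≠ 0 := ht₀.ne
        field_simp
      set σ := ∑ i, ∑ j, (((1 / 2 : ℝ) • (M + Mᵀ)) i j) ^ 2 with hσ
      set μ := (Matrix.isHermitian_add_transpose_self M).eigenvalues₀ 1 with hμ
      have hσK : σ * (-t₀) ^ 2 ≤ K ^ 2 := by
        rw [← hKt]
        exact mul_le_mul_of_nonneg_right hS (sq_nonneg _)
      calc 6 * m ^ 2 = (3 / 2 * μ ^ 2) * (-t₀) ^ 2 := by rw [hΛ]; ring
        _ ≤ σ * (-t₀) ^ 2 := mul_le_mul_of_nonneg_right hsix (sq_nonneg _)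
        _ ≤ K ^ 2 := hσK
    -- the threshold actually used is nonnegative: `b ≥ 2m/3 ≥ 0`
    have hb0 : 0 ≤ b := by
      have hK2 : 0 < K ^ 2 := by positivity
      have h1' : 2 * m ^ 3 / K ^ 2 ≤ m / 3 := by
        rw [div_le_iff₀ hK2]
        nlinarith
      rw [hb]
      linarith
    -- the production ceiling at every point of `u`
    have hceil : ProdCeiling b u := by
      intro t ht x
      have ht' : 0 < -t := neg_pos.2 ht
      set M := stdMatrix (fderiv ℝ (u t) x : ℝ³ →ₗ[ℝ] ℝ³) with hM
      have hΛle_u : lerayMiddleStrain u t x ≤ m := hΛle u ⟨h1, h2, h3, h4, h5⟩ t ht x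
      have hΛ : lerayMiddleStrain u t x =
          (-t) * (2⁻¹ * (Matrix.isHermitian_add_transpose_self M).eigenvalues₀ 1) :=
        lerayMiddleStrain_eq_eigenvalues₀
      have hμ : (Matrix.isHermitian_add_transpose_self M).eigenvalues₀ 1 ≤ 2 * (m / (-t)) := by
        rw [hΛ] at hΛle_u
        rw [mul_div_assoc', le_div_iff₀ ht']
        nlinarith
      have hmK : 6 * (m / (-t)) ^ 2 ≤ (K / (-t)) ^ 2 := by
        rw [div_pow, div_pow]
        exact (by
          rw [← mul_div_assoc]
          exact div_le_div_of_nonneg_right h6 (sq_nonneg _) :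
            6 * (m ^ 2 / (-t) ^ 2) ≤ K ^ 2 / (-t) ^ 2)
      have hcub := stub_cubicProductionBound M (m / (-t)) (K / (-t)) (htr t ht x)
        (div_nonneg hm0 ht'.le) (div_pos hK ht') hmK hμ (hKb u ⟨h1, h2, h3, h4, h5⟩ t ht x)
      have hcoef : 2 * (m / (-t)) - 4 * (m / (-t)) ^ 3 / (K / (-t)) ^ 2 = 2 * b / (-t) := by
        rw [hb]
        field_simp
        ring
      rw [hcoef] at hcub
      exact hcub
    have hz : ∀ t < 0, ∀ x, u t x = 0 := hL C b hb0 hreg u ⟨h1, h2, h3, h4, h5⟩ hceil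
    have hm : m ≤ 0 := nonpos_of_twoFrame_lower_of_slice_zero (hz t₀ ht₀) hGE
    linarith

/-- **X ⇔ (the leaky stub on `[0,1/4)`) ∧ `stub_largeExcessExclusion`.** -/
theorem squeezeLiouville_iff_leakyNonneg_and_largeExcess (hG : S_stub_gaugeStrainBound) :
    SqueezeCycle.SqueezeLiouville ↔ LeakyNonneg ∧ S_stub_largeExcessExclusion := by
  constructor
  · intro hX
    exact ⟨fun C _ _ _ u hu _ => hX C u hu,
      largeExcess_of_crux (extremalBiaxialitySubcritical_of_squeezeLiouville hX)⟩
  · rintro ⟨hL, hE⟩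
    exact squeezeLiouville_of_mustSqueeze_of_withoutMaximality
      (msFamily_of_leakyNonneg hL (1 / 8) (by norm_num))
      (withoutMaximality_of_crux (crux_of_leakyNonneg_of_largeExcess hG hL hE))

/-- **The open stub pair of line `quarter-bootstrap-pinning` is EQUIVALENT to the route target**
`SqueezeLiouville` (X): `X ⇔ stub_leakyQuarterLawCeiling ∧ stub_largeExcessExclusion`. The line can
close the crux only by closing X outright — i.e. the crux AND the sibling crux `MustSqueeze`
(`squeezeLiouville ⇔ MustSqueeze ∧ crux`, disprover gen 3) — and a kill of either stub is `¬X`. -/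
theorem squeezeLiouville_iff_leaky_and_largeExcess (hG : S_stub_gaugeStrainBound) :
    SqueezeCycle.SqueezeLiouville ↔ S_stub_leakyQuarterLawCeiling ∧ S_stub_largeExcessExclusion := by
  rw [leaky_iff_leakyNonneg]
  exact squeezeLiouville_iff_leakyNonneg_and_largeExcess hG

/-- Bookkeeping: no kill of the stub pair short of `¬X` (a nontrivial Type-I ancient element). -/
theorem not_squeezeLiouville_iff (hG : S_stub_gaugeStrainBound) :
    ¬ SqueezeCycle.SqueezeLiouville ↔ ¬ S_stub_leakyQuarterLawCeiling ∨ ¬ S_stub_largeExcessExclusion := by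
  rw [squeezeLiouville_iff_leaky_and_largeExcess hG, not_and_or]

/-! ## §4 What the production-currency leaky law buys beyond the Λ-family: the value `1/4` -/

/-- **Given the `MustSqueeze` family below `1/4` (Λ-currency — what the sibling line delivers, and what
the leaky stub implies), the crux is `stub_largeExcessExclusion` ("`Λ ≤ 1/4` everywhere") plus the
exclusion of the single value `Λ = 1/4`** (anywhere in any class). That boundary value is the entire
purchase of the cubic refinement `b = m − 2m³/K²` and of stating the leaky law in production currency. -/
theorem crux_iff_largeExcess_and_ne_quarter (hG : S_stub_gaugeStrainBound) (hMS : MSFamily) :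
    SqueezeCycle.ExtremalBiaxialitySubcritical ↔
      S_stub_largeExcessExclusion ∧
        ∀ (C : ℝ) (u : ℝ → ℝ³ → ℝ³), InK C u → ∀ t < 0, ∀ x, lerayMiddleStrain u t x ≠ 1 / 4 := by
  rw [crux_iff_forall_lerayMiddleStrain_lt_quarter hMS, largeExcess_iff_forall_le_quarter hG]
  constructor
  · intro h
    exact ⟨fun C u hu t ht x => (h C u hu t ht x).le, fun C u hu t ht x => (h C u hu t ht x).ne⟩
  · rintro ⟨h1, h2⟩ C u hu t ht x
    exact lt_of_le_of_ne (h1 C u hu t ht x) (h2 C u hu t ht x)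

/-- … equivalently, given the family, **crux ⇔ `stub_largeExcessExclusion` ∧ "no class has an attained
maximum equal to `1/4`"**, in the crux's own two-frame vocabulary. -/
theorem crux_iff_largeExcess_and_noQuarterMax (hG : S_stub_gaugeStrainBound) (hMS : MSFamily) :
    SqueezeCycle.ExtremalBiaxialitySubcritical ↔
      S_stub_largeExcessExclusion ∧
        ∀ (C : ℝ) (u : ℝ → ℝ³ → ℝ³) (t₀ : ℝ) (x₀ : ℝ³), t₀ < 0 → InK C u →
          (1 / 4 : ℝ) ≤ lerayMiddleStrain u t₀ x₀ →
          (∀ v' : ℝ → ℝ³ → ℝ³, InK C v' → ∀ t < 0, ∀ x, lerayMiddleStrain v' t x ≤ 1 / 4) → False := by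
  rw [crux_iff_largeExcess_and_ne_quarter hG hMS]
  refine ⟨fun ⟨hE, hne⟩ => ⟨hE, fun C u t₀ x₀ ht₀ hu hge hle => ?_⟩, fun ⟨hE, hno⟩ => ⟨hE, ?_⟩⟩
  · exact hne C u hu t₀ ht₀ x₀ (le_antisymm (hle u hu t₀ ht₀ x₀) hge)
  · intro C u hu t ht x heq
    exact hno C u t x ht hu heq.ge ((largeExcess_iff_forall_le_quarter hG).1 hE C)

/-! ## §5 Unconditional forms (hG discharged by the landed `stub_gaugeStrainBound`) -/

/-- **`stub_largeExcessExclusion ⇔ Λ ≤ 1/4 pointwise on every 𝒦_C`** — no hypothesis. -/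
theorem largeExcess_iff_forall_le_quarter' :
    S_stub_largeExcessExclusion ↔
      ∀ (C : ℝ) (u : ℝ → ℝ³ → ℝ³), InK C u → ∀ t < 0, ∀ x, lerayMiddleStrain u t x ≤ 1 / 4 :=
  largeExcess_iff_forall_le_quarter gaugeStrainBound_landed

/-- **X ⇔ the open stub pair** — no hypothesis. -/
theorem squeezeLiouville_iff_leaky_and_largeExcess' :
    SqueezeCycle.SqueezeLiouville ↔ S_stub_leakyQuarterLawCeiling ∧ S_stub_largeExcessExclusion :=
  squeezeLiouville_iff_leaky_and_largeExcess gaugeStrainBound_landed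

/-- **¬X ⇔ one of the two open stubs fails** — no hypothesis. -/
theorem not_squeezeLiouville_iff' :
    ¬ SqueezeCycle.SqueezeLiouville ↔ ¬ S_stub_leakyQuarterLawCeiling ∨ ¬ S_stub_largeExcessExclusion :=
  not_squeezeLiouville_iff gaugeStrainBound_landed

/-- **Given only the Λ-family: crux ⇔ `stub_largeExcessExclusion` ∧ (`Λ ≠ 1/4` everywhere).** -/
theorem crux_iff_largeExcess_and_ne_quarter' (hMS : MSFamily) :
    SqueezeCycle.ExtremalBiaxialitySubcritical ↔
      S_stub_largeExcessExclusion ∧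
        ∀ (C : ℝ) (u : ℝ → ℝ³ → ℝ³), InK C u → ∀ t < 0, ∀ x, lerayMiddleStrain u t x ≠ 1 / 4 :=
  crux_iff_largeExcess_and_ne_quarter gaugeStrainBound_landed hMS

/-- In particular, under this line's leaky stub alone: crux ⇔ `stub_largeExcessExclusion` ∧ (`Λ ≠ 1/4`
everywhere) — the family being supplied by `msFamily_of_leakyNonneg`. -/
theorem crux_iff_largeExcess_and_ne_quarter_of_leaky (hL : S_stub_leakyQuarterLawCeiling) :
    SqueezeCycle.ExtremalBiaxialitySubcritical ↔
      S_stub_largeExcessExclusion ∧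
        ∀ (C : ℝ) (u : ℝ → ℝ³ → ℝ³), InK C u → ∀ t < 0, ∀ x, lerayMiddleStrain u t x ≠ 1 / 4 :=
  crux_iff_largeExcess_and_ne_quarter' (msFamily_of_leakyNonneg (leaky_iff_leakyNonneg.1 hL))

end Summit.NavierStokesRegularity.NavierStokesRegularity.Cruxes.ExtremalBiaxialitySubcritical.DrefuteQBP2

end
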